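import Summits.NavierStokesRegularity.NavierStokesRegularity.Theorems.AdaptedFrequencyConverges.Negative.SmallOscillation
import Summits.NavierStokesRegularity.NavierStokesRegularity.Theorems.AdaptedFrequencyConverges.Negative.LineStubsActive

/-!
# No smallness threshold rescues `stub_slowDecrease` without a far-field input

Negative-side support for crux `AdaptedFrequencyConverges` (stmt-NavierStokesRegularity-10493), cdisprove seat,
cycle 2.  For every `δ > 0` the δ-small strengthening of the lead's active `stub_slowDecrease` WITHOUT its
far-field hypotheses — local Type-I constant `≤ δ`, kernel within `e^{±δ}` of the backward heat kernel's
constants, oscillation budget `|Λ| ≤ δ` eventually — is still false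
(`stub_slowDecrease_false_without_decay_small`): witnessed by the ε-flow of `…Negative.EpsFlow` /
`…Negative.SmallOscillation` (exact NS, exact near-Gaussian adapted kernel `GE`), whose adapted frequency
`Λ = 2ε cos log(1−t)` (`adaptedFrequency_velE`) drops by `4ε sin(1/3) > ε` over the late dyadic windows of
`…Negative.LineStubsActive.two_cos_log_window`.  Companion of `…SmallOscillation.
adaptedFrequencyConverges_false_without_decay_small` (same ε-flow, crux level).
-/

noncomputable section

namespace Summit.NavierStokesRegularity.NavierStokesRegularity.Theorems.AdaptedFrequencyConverges.Negative

open scoped Topology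
open Literature.Analysis.FluidPDE Set Filter MeasureTheory Real


/-- The adapted frequency of the ε-flow about the pole `(1,0)` is `2ε cos log(1−t)`. [folklore] -/
theorem adaptedFrequency_velE {ν : ℝ} (hν : 0 < ν) (ε : ℝ) {t : ℝ} (ht : t < 1) :
    adaptedFrequency (velE ε) (GE ν ε) 1 t = 2 * ε * Real.cos (Real.log (1 - t)) :=
  frequencyE_eq hν ε (H := adaptedEnstrophy (velE ε) (GE ν ε))
    (Λ := adaptedFrequency (velE ε) (GE ν ε) 1) rfl rfl ht

/-- The ε-kernel is an adapted backward kernel on `[0,1)` with pole `(1,0)`. [folklore] -/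
theorem isAdaptedBackwardKernel_GE {ν : ℝ} (hν : 0 < ν) (ε : ℝ) :
    IsAdaptedBackwardKernel ν (velE ε) (Ico 0 1) 1 0 (GE ν ε) :=
  ⟨(contDiffOn_uncurry_GE ν hν ε (n := 2)).mono (prod_mono Ico_subset_Iio_self Subset.rfl),
    fun _ ht x => GE_pos hν ε ht.2 x, fun _ ht x => adjoint_eq_GE hν ε ht x,
    fun _ ht => integral_GE hν ε ht.2, fun _ hφ hM => tendsto_integral_mul_GE hν ε hφ hM⟩

/-- `2ε cos log(1−t)` drops by `4ε sin(1/3) > ε` over the late dyadic windows of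
`two_cos_log_window`. [folklore] -/
theorem not_slowlyDecreasing_two_eps_cos_log {ε : ℝ} (hε : 0 < ε) :
    ¬ (∀ ε' : ℝ, 0 < ε' → ∃ t₁ : ℝ, t₁ < 1 ∧ ∀ t t' : ℝ, t₁ ≤ t → t ≤ t' → t' < 1 →
        1 - t ≤ 2 * (1 - t') →
        2 * ε * Real.cos (Real.log (1 - t)) ≤ 2 * ε * Real.cos (Real.log (1 - t')) + ε') := by
  intro h
  obtain ⟨t₁, ht₁, hsd⟩ := h ε hε
  have hlim : Tendsto (fun n : ℕ => Real.exp (-(π / 2 - 1 / 3 + n * (2 * π)))) atTop (𝓝 0) := by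
    have h1 : Tendsto (fun n : ℕ => π / 2 - 1 / 3 + (n : ℝ) * (2 * π)) atTop atTop :=
      tendsto_atTop_add_const_left _ _ (tendsto_natCast_atTop_atTop.atTop_mul_const (by positivity))
    exact Real.tendsto_exp_neg_atTop_nhds_zero.comp h1
  obtain ⟨n, hn⟩ := (hlim.eventually (eventually_lt_nhds (sub_pos.2 ht₁))).exists
  obtain ⟨h1, h2, h3, h4⟩ := two_cos_log_window n
  have h5 := hsd _ _ (by linarith) h1 h2 h3
  have h6 := mul_lt_mul_of_pos_left h4 hε
  nlinarith

/-- **No smallness threshold rescues `stub_slowDecrease` without a far-field hypothesis.**  For every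
`δ > 0` the following δ-small strengthening of the weakened stub is still false: local Type-I constant
`≤ δ`, kernel within `e^{±δ}` of the backward heat kernel's constants, oscillation budget
`|Λ| ≤ δ` eventually — and yet `Λ` is not slowly decreasing.  Witness: the ε-flow of Part F with
`ε = δ/(4(‖D₀‖+1))`, `Λ = 2ε cos log(1−t)`. [folklore] -/
theorem stub_slowDecrease_false_without_decay_small {δ : ℝ} (hδ : 0 < δ) :
    ¬ (∀ (ν T : ℝ) (u : ℝ → EuclideanSpace ℝ (Fin 3) → EuclideanSpace ℝ (Fin 3))
        (p : ℝ → EuclideanSpace ℝ (Fin 3) → ℝ) (x₀ : EuclideanSpace ℝ (Fin 3)) (t₀ : ℝ)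
        (G : ℝ → EuclideanSpace ℝ (Fin 3) → ℝ), 0 < ν → 0 < T →
        IsClassicalNSSolutionOn (Ico 0 T) ν 0 u p →
        (∀ᶠ t in 𝓝[<] T, ∀ x, ‖x - x₀‖ ^ 2 ≤ T - t → ‖u t x‖ ≤ δ / Real.sqrt (T - t)) →
        t₀ ∈ Ico 0 T →
        (∀ r : ℝ, 0 < r → eLpNorm (Function.uncurry u) ⊤
          (volume.restrict (parabolicCylinder r (T, x₀))) = ⊤) →
        IsAdaptedBackwardKernel ν u (Ico t₀ T) T x₀ G →
        (∀ t ∈ Set.Ico t₀ T, ∀ x, (4 * π * ν * Real.exp δ) ^ (-(3:ℝ) / 2) * (T - t) ^ (-(3:ℝ) / 2) *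
            Real.exp (-(‖x - x₀‖ ^ 2) / ((4 * ν * Real.exp (-δ)) * (T - t))) ≤ G t x ∧
          G t x ≤ (4 * π * ν * Real.exp (-δ)) ^ (-(3:ℝ) / 2) * (T - t) ^ (-(3:ℝ) / 2) *
            Real.exp (-(‖x - x₀‖ ^ 2) / ((4 * ν * Real.exp δ) * (T - t)))) →
        (∀ᶠ t in 𝓝[<] T, |adaptedFrequency u G T t| ≤ δ) →
        ∀ ε : ℝ, 0 < ε → ∃ t₁ : ℝ, t₁ < T ∧ ∀ t t' : ℝ, t₁ ≤ t → t ≤ t' → t' < T →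
          T - t ≤ 2 * (T - t') → adaptedFrequency u G T t ≤ adaptedFrequency u G T t' + ε) := by
  intro h
  set ε : ℝ := δ / (4 * (‖D0‖ + 1)) with hε
  have hD : 0 ≤ ‖D0‖ := norm_nonneg _
  have hε0 : 0 < ε := by rw [hε]; positivity
  have hεabs : |ε| = ε := abs_of_pos hε0
  have hε4 : 4 * |ε| ≤ δ := by
    rw [hεabs, hε, div_eq_mul_inv]
    have : (4 * (‖D0‖ + 1))⁻¹ ≤ 4⁻¹ := by
      apply inv_anti₀ (by norm_num); nlinarith
    nlinarith
  have hεD : |ε| * ‖D0‖ + |ε| ≤ δ := by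
    rw [hεabs, hε]
    rw [show δ / (4 * (‖D0‖ + 1)) * ‖D0‖ + δ / (4 * (‖D0‖ + 1)) = δ * ((‖D0‖ + 1) / (4 * (‖D0‖ + 1))) by ring]
    rw [show (‖D0‖ + 1) / (4 * (‖D0‖ + 1)) = 1 / 4 by field_simp]
    linarith
  have h1 : (0:ℝ) < 1 := one_pos
  -- local Type-I with constant ≤ δ
  have hTI : ∀ᶠ t in 𝓝[<] (1:ℝ), ∀ x : E3, ‖x - 0‖ ^ 2 ≤ 1 - t →
      ‖velE ε t x‖ ≤ δ / Real.sqrt (1 - t) := by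
    filter_upwards [local_typeI_velE ε hε0, self_mem_nhdsWithin] with t ht ht1 x hx
    refine (ht x hx).trans (div_le_div_of_nonneg_right ?_ (Real.sqrt_nonneg _))
    linarith
  -- comparability with δ-constants from the 4|ε|-constants
  have hcomp : ∀ t ∈ Set.Ico (0:ℝ) 1, ∀ x : E3,
      (4 * π * 1 * Real.exp δ) ^ (-(3:ℝ) / 2) * (1 - t) ^ (-(3:ℝ) / 2) *
          Real.exp (-(‖x - 0‖ ^ 2) / ((4 * 1 * Real.exp (-δ)) * (1 - t))) ≤ GE 1 ε t x ∧
        GE 1 ε t x ≤ (4 * π * 1 * Real.exp (-δ)) ^ (-(3:ℝ) / 2) * (1 - t) ^ (-(3:ℝ) / 2) *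
          Real.exp (-(‖x - 0‖ ^ 2) / ((4 * 1 * Real.exp δ) * (1 - t))) := by
    intro t ht x
    obtain ⟨hlo, hhi⟩ := GE_comparable h1 ε t ht x
    have hτ : 0 < 1 - t := sub_pos.2 ht.2
    have hn : 0 ≤ ‖x - 0‖ ^ 2 := sq_nonneg _
    have e1 : Real.exp (4 * |ε|) ≤ Real.exp δ := Real.exp_le_exp.2 hε4
    have e2 : Real.exp (-δ) ≤ Real.exp (-(4 * |ε|)) := Real.exp_le_exp.2 (by linarith)
    constructor
    · refine le_trans ?_ hlo
      have hA : (4 * π * 1 * Real.exp δ) ^ (-(3:ℝ) / 2) ≤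
          (2 * π * (2 * 1 * Real.exp (4 * |ε|))) ^ (-(3:ℝ) / 2) := by
        apply Real.rpow_le_rpow_of_nonpos (by positivity) ?_ (by norm_num)
        nlinarith [Real.pi_pos]
      have hB : Real.exp (-(‖x - 0‖ ^ 2) / ((4 * 1 * Real.exp (-δ)) * (1 - t))) ≤
          Real.exp (-(‖x - 0‖ ^ 2) / ((4 * 1 * Real.exp (-(4 * |ε|))) * (1 - t))) := by
        rw [Real.exp_le_exp, neg_div, neg_div, neg_le_neg_iff]
        apply div_le_div_of_nonneg_left hn (by positivity)
        gcongr
      exact mul_le_mul (mul_le_mul_of_nonneg_right hA (by positivity)) hB (by positivity)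
        (by positivity)
    · refine le_trans hhi ?_
      have hA : (2 * π * (2 * 1 * Real.exp (-(4 * |ε|)))) ^ (-(3:ℝ) / 2) ≤
          (4 * π * 1 * Real.exp (-δ)) ^ (-(3:ℝ) / 2) := by
        apply Real.rpow_le_rpow_of_nonpos (by positivity) ?_ (by norm_num)
        nlinarith [Real.pi_pos]
      have hB : Real.exp (-(‖x - 0‖ ^ 2) / ((4 * 1 * Real.exp (4 * |ε|)) * (1 - t))) ≤
          Real.exp (-(‖x - 0‖ ^ 2) / ((4 * 1 * Real.exp δ) * (1 - t))) := by
        rw [Real.exp_le_exp, neg_div, neg_div, neg_le_neg_iff]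
        apply div_le_div_of_nonneg_left hn (by positivity)
        gcongr
      exact mul_le_mul (mul_le_mul_of_nonneg_right hA (by positivity)) hB (by positivity)
        (by positivity)
  -- oscillation budget |Λ| ≤ 2|ε| ≤ δ
  have hosc : ∀ᶠ t in 𝓝[<] (1:ℝ), |adaptedFrequency (velE ε) (GE 1 ε) 1 t| ≤ δ := by
    filter_upwards [Ico_mem_nhdsLT zero_lt_one] with t ht
    rw [adaptedFrequency_velE h1 ε ht.2, abs_mul, abs_mul, abs_two, hεabs]
    have := Real.abs_cos_le_one (Real.log (1 - t))
    nlinarith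
  have hW := h 1 1 (velE ε) (presE ε) 0 0 (GE 1 ε) h1 h1 (isClassicalNSSolutionOn_velE ε 1) hTI
    ⟨le_rfl, h1⟩ (singular_velE hε0.ne') (isAdaptedBackwardKernel_GE h1 ε) hcomp hosc
  refine not_slowlyDecreasing_two_eps_cos_log hε0 fun ε' hε' => ?_
  obtain ⟨t₁, ht₁, hsd⟩ := hW ε' hε'
  refine ⟨t₁, ht₁, fun t t' h1t h2 h3 h4 => ?_⟩
  have h5 := hsd t t' h1t h2 h3 h4
  rwa [adaptedFrequency_velE h1 ε (h2.trans_lt h3), adaptedFrequency_velE h1 ε h3] at h5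


end Summit.NavierStokesRegularity.NavierStokesRegularity.Theorems.AdaptedFrequencyConverges.Negative

end
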